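import Mathlib.Combinatorics.SetFamily.Compression.UV
import Mathlib.Combinatorics.Hall.Basic
import Mathlib.Combinatorics.Enumerative.DoubleCounting
import Mathlib.Data.Finset.Sups
import Mathlib.Order.UpperLower.Basic

/-!
# `NoHeavyLowerTail` (crux stmt-CriticalPhenomena-4575), lane prim-ineq-gen-4 (gen 34): the CYLINDER LEMMA for the anti-band inequality (AB_l)

Support file (`--supports stmt-CriticalPhenomena-4575`; memo `run/shared/lean/prim/prim-ineq-gen-4/FINDING-CYLINDER-g34.md` §1).
Pure finite combinatorics, no definitions, no `sorry`, standard axioms.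

(AB_l) for families `W, V` of finsets of a finite type `β` (`V` an upper set) asks
`#{s ∈ W ∩ Vᶜˢ | outer s} ≤ #{s ∈ W ∩ V | outer s}`, `outer s :↔ #s < l ∨ #sᶜ < l` (gen 19–33 files `…AntiBand*`).

* `cylinder_antiBand` (THE CYLINDER LEMMA).  Let `C = [m, M] = {x | m ⊆ x ⊆ M}` be a Boolean interval ("cylinder") with `card β ≤ 2·#m + #(M \ m)`
  (equivalently `#Mᶜ ≤ #m`) and suppose `V` is an upper set such that `Mᶜ ∪ w ∈ V → m ∪ w ∈ V` for every `w ⊆ M \ m` ("`m` dominates `Mᶜ` in the eyes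
  of `V`").  Then `#{x ∈ C ∩ Vᶜˢ | outer x} ≤ #{x ∈ C ∩ V | outer x}` for EVERY `l`.  Proof: an explicit injection `x ↦ m ∪ Ψ(M \ x)`, `Ψ w = w` when
  `m ∪ w` is outer and otherwise `Ψ w = τ w`, a containment injection from the `j`-subsets of `Z = M \ m` into its `(#Z − j)`-subsets (`2j < #Z`),
  obtained from Hall's theorem by degree counting.
* `antiBand_of_cylinder_partition` : if the outer part of `W` is partitioned by such cylinders, (AB_l)(W, V) holds.
* `antiBand_principal_filter` : the one-cylinder case `[m, univ]` — (AB_l)(↑m, V) for every `m`, every upper set `V`, every `l` (gen 32's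
  `AntiBandPrincipal` theorem, here in twenty lines and without the hypotheses `1 ≤ l`, `2l ≤ card β`).
* `insert_erase_mem_of_isCompressed`, `sdiff_union_image_mem_of_isCompressed`, `dominates_of_isCompressed` : for a RIGHT-shifted upper set `V` on
  `Fin n` (compressed along `({j},{i})` for all `i < j`) the domination hypothesis of the cylinder lemma follows from an injection `π : Mᶜ → m` with
  `i < π i` — so every left-shifted `W` whose outer part splits into such cylinders satisfies (AB_l) against all right-shifted `V`
  (`antiBand_of_dominated_cylinders`); by gen 20's opposite-compression lemma this is the relevant case.
The Hall-type level injection `exists_mirror_injection` is proved inline (gen 33's `…AntiBandThreshold.exists_grow_injection` is the general form,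
but that module has no olean on the farm at the time of writing, so it cannot be imported).
-/

namespace Summit.CriticalPhenomena.PercolationContinuityZ3.Theorems.AntiBandCylinder

open Finset
open scoped FinsetFamily

section Hall

/-- **Containment injection between mirror levels of a cube**: for `2j < #Z`, the `j`-subsets of `Z` inject into the `(#Z − j)`-subsets of `Z` along `⊆`
(the symmetric-chain / normalized-matching property of `2^Z`).  Proof: Hall's marriage theorem, Hall's condition by double counting — each `j`-set lies in
`C(#Z−2j+j…) = C(#Z−j, #Z−2j) = C(#Z−j, j)` sets of size `#Z−j`, and each `(#Z−j)`-set contains `C(#Z−j, j)` sets of size `j`.  (Gen 33's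
`AntiBandThreshold.exists_grow_injection` is the general statement; that module has no olean on the farm yet, so the argument is inlined.) [folklore] -/
theorem exists_mirror_injection {α : Type*} [DecidableEq α] (Z : Finset α) (j : ℕ) (hj : 2 * j < #Z) :
    ∃ τ : Finset α → Finset α, Set.InjOn τ (Z.powersetCard j) ∧
      ∀ w ∈ Z.powersetCard j, τ w ∈ Z.powersetCard (#Z - j) ∧ w ⊆ τ w := by
  classical
  set X : Finset (Finset α) := Z.powersetCard j with hXdef
  set Y : Finset (Finset α) := Z.powersetCard (#Z - j) with hYdef
  set d : ℕ := (#Z - j).choose j with hd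
  have hdpos : 0 < d := Nat.choose_pos (by omega)
  -- left degrees: the `(#Z−j)`-supersets of a `j`-set `w ⊆ Z` are `C(#Z−j, #Z−j−j) = d` many
  have hX : ∀ w ∈ X, d ≤ #(Y.filter fun y => w ⊆ y) := by
    intro w hw
    rw [hXdef, mem_powersetCard] at hw
    have hcnt : #(Y.filter fun y => w ⊆ y) = (#(Z \ w)).choose (#Z - j - j) := by
      rw [← card_powersetCard (#Z - j - j) (Z \ w)]
      refine card_bij (fun R _ => R \ w) (fun R hR => ?_) (fun R₁ hR₁ R₂ hR₂ h => ?_) (fun Q hQ => ?_)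
      · rw [mem_filter, hYdef, mem_powersetCard] at hR
        rw [mem_powersetCard, card_sdiff_of_subset hR.2, hR.1.2, hw.2]
        exact ⟨sdiff_subset_sdiff hR.1.1 le_rfl, rfl⟩
      · rw [mem_filter] at hR₁ hR₂
        have h' : R₁ \ w ∪ w = R₂ \ w ∪ w := by rw [h]
        rwa [sdiff_union_of_subset hR₁.2, sdiff_union_of_subset hR₂.2] at h'
      · rw [mem_powersetCard] at hQ
        have hQdisj : Disjoint Q w := Finset.disjoint_left.2 fun x hx hx' => (mem_sdiff.1 (hQ.1 hx)).2 hx'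
        refine ⟨Q ∪ w, ?_, union_sdiff_cancel_right hQdisj⟩
        rw [mem_filter, hYdef, mem_powersetCard, card_union_of_disjoint hQdisj, hQ.2, hw.2]
        exact ⟨⟨union_subset (fun x hx => (mem_sdiff.1 (hQ.1 hx)).1) hw.1, by omega⟩, subset_union_right⟩
    rw [hcnt, card_sdiff_of_subset hw.1, hw.2, hd, Nat.choose_symm (by omega)]
  -- right degrees: a `(#Z−j)`-set contains `C(#Z−j, j) = d` sets of size `j`
  have hY : ∀ y ∈ Y, #(X.filter fun w => w ⊆ y) ≤ d := by
    intro y hy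
    rw [hYdef, mem_powersetCard] at hy
    have : X.filter (fun w => w ⊆ y) = y.powersetCard j := by
      ext w; rw [mem_filter, hXdef, mem_powersetCard, mem_powersetCard]
      exact ⟨fun h => ⟨h.2, h.1.2⟩, fun h => ⟨⟨h.1.trans hy.1, h.2⟩, h.1⟩⟩
    rw [this, card_powersetCard, hy.2]
  -- Hall's condition by double counting, then the marriage theorem
  let t : X → Finset (Finset α) := fun w => Y.filter fun y => w.1 ⊆ y
  have hHall : ∀ S : Finset X, #S ≤ #(S.biUnion t) := by
    intro S
    set S' : Finset (Finset α) := S.map (Function.Embedding.subtype _) with hS'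
    have hS'X : S' ⊆ X := fun u hu => by obtain ⟨a, -, rfl⟩ := mem_map.1 hu; exact a.2
    have key : #S' * d ≤ #(S.biUnion t) * d := by
      refine card_mul_le_card_mul (fun x y => x ⊆ y) (fun x hx => ?_) (fun y hy => ?_)
      · obtain ⟨a, ha, hax⟩ := mem_map.1 hx
        refine (hX x (hS'X hx)).trans (card_le_card fun y hy => ?_)
        rw [mem_filter] at hy
        rw [mem_bipartiteAbove]
        refine ⟨mem_biUnion.2 ⟨a, ha, ?_⟩, hy.2⟩
        show y ∈ Y.filter fun y => a.1 ⊆ y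
        rw [show (a : Finset α) = x from hax, mem_filter]; exact hy
      · have hyY : y ∈ Y := by obtain ⟨a, -, hay⟩ := mem_biUnion.1 hy; exact (mem_filter.1 hay).1
        refine (card_le_card fun x hx => ?_).trans (hY y hyY)
        rw [mem_bipartiteBelow] at hx
        exact mem_filter.2 ⟨hS'X hx.1, hx.2⟩
    rw [← card_map (Function.Embedding.subtype _)]
    exact Nat.le_of_mul_le_mul_right key hdpos
  obtain ⟨f, hfinj, hft⟩ := (all_card_le_biUnion_card_iff_exists_injective t).1 hHall
  refine ⟨fun x => if h : x ∈ X then f ⟨x, h⟩ else x, fun x hx x' hx' h => ?_, fun x hx => ?_⟩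
  · have hxX : x ∈ X := hx
    have hx'X : x' ∈ X := hx'
    simp only [dif_pos hxX, dif_pos hx'X] at h
    exact congrArg Subtype.val (hfinj h)
  · have hxX : x ∈ X := hx
    simp only [dif_pos hxX]
    exact ⟨(mem_filter.1 (hft ⟨x, hxX⟩)).1, (mem_filter.1 (hft ⟨x, hxX⟩)).2⟩

end Hall

variable {β : Type*} [DecidableEq β] [Fintype β]

/-- **THE CYLINDER LEMMA.**  Let `V` be an upper set, `m ⊆ M`, `card β ≤ 2·#m + #(M \ m)`, and assume `Mᶜ ∪ w ∈ V → m ∪ w ∈ V` for all `w ⊆ M \ m`.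
Then on the cylinder `C = {x | m ⊆ x ⊆ M}`: `#{x ∈ C ∩ Vᶜˢ | #x < l ∨ #xᶜ < l} ≤ #{x ∈ C ∩ V | #x < l ∨ #xᶜ < l}` for every `l`.
[this work, FINDING-CYLINDER-g34.md §1] -/
theorem cylinder_antiBand (l : ℕ) (V : Finset (Finset β)) (hV : IsUpperSet (V : Set (Finset β))) (m M : Finset β) (hmM : m ⊆ M)
    (hsize : Fintype.card β ≤ 2 * #m + #(M \ m)) (hdom : ∀ w ⊆ M \ m, Mᶜ ∪ w ∈ V → m ∪ w ∈ V) :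
    #(((M.powerset.filter fun x => m ⊆ x) ∩ Vᶜˢ).filter fun s => #s < l ∨ #sᶜ < l)
      ≤ #(((M.powerset.filter fun x => m ⊆ x) ∩ V).filter fun s => #s < l ∨ #sᶜ < l) := by
  classical
  set n : ℕ := Fintype.card β with hn
  set Z : Finset β := M \ m with hZ
  set q : ℕ := #Z with hq
  have hcc : ∀ s : Finset β, #sᶜ = n - #s := fun s => by rw [card_compl]
  have hle : ∀ s : Finset β, #s ≤ n := fun s => card_le_univ s
  -- mirror injections, one per level `j` with `2j < q`
  have hτ : ∀ j : ℕ, ∃ τ : Finset β → Finset β, 2 * j < q → (Set.InjOn τ (Z.powersetCard j) ∧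
      ∀ w ∈ Z.powersetCard j, τ w ∈ Z.powersetCard (q - j) ∧ w ⊆ τ w) := by
    intro j
    by_cases h : 2 * j < q
    · obtain ⟨τ, hτ⟩ := exists_mirror_injection Z j h; exact ⟨τ, fun _ => hτ⟩
    · exact ⟨id, fun h' => absurd h' h⟩
  choose τ hτ using hτ
  -- the map (`P w` : `m ∪ w` is outer; all size conditions are written additively)
  let Ψ : Finset β → Finset β := fun w => if #m + #w < l ∨ n < l + (#m + #w) then w else τ #w w
  let Φ : Finset β → Finset β := fun x => m ∪ Ψ (M \ x)
  -- basic facts about members of the cylinder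
  have hcyl : ∀ x : Finset β, x ∈ M.powerset.filter (fun x => m ⊆ x) ↔ m ⊆ x ∧ x ⊆ M := fun x => by
    rw [mem_filter, mem_powerset]; exact and_comm
  have hwZ : ∀ x : Finset β, x ⊆ M → m ⊆ x → M \ x ⊆ Z := fun x _ hmx => sdiff_subset_sdiff le_rfl hmx
  have hwcard : ∀ x : Finset β, x ⊆ M → m ⊆ x → #(M \ x) + #x = #m + q ∧ #m ≤ #x ∧ #(M \ x) ≤ q := by
    intro x hxM hmx
    have h1 := card_le_card hxM; have h2 := card_le_card hmx; have h3 := card_le_card (hwZ x hxM hmx)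
    refine ⟨?_, h2, by rw [hq]; exact h3⟩
    rw [card_sdiff_of_subset hxM, hq, hZ, card_sdiff_of_subset hmM]; omega
  have hcompl : ∀ x : Finset β, x ⊆ M → xᶜ = Mᶜ ∪ (M \ x) := by
    intro x hxM; ext a; rw [mem_compl, mem_union, mem_compl, mem_sdiff]
    constructor
    · intro ha; by_cases haM : a ∈ M; exacts [Or.inr ⟨haM, ha⟩, Or.inl haM]
    · rintro (h | h); exacts [fun ha => h (hxM ha), h.2]
  have hmZ : Disjoint m Z := by rw [hZ]; exact disjoint_sdiff
  have hcardmw : ∀ w : Finset β, w ⊆ Z → #(m ∪ w) = #m + #w := fun w hw =>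
    card_union_of_disjoint (hmZ.mono_right hw)
  -- behaviour of `Ψ` on `w ⊆ Z` when `x = M \ w` is outer (`P' w`)
  have hΨ : ∀ w : Finset β, w ⊆ Z → (#m + q < l + #w ∨ n + #w < l + (#m + q)) →
      Ψ w ⊆ Z ∧ w ⊆ Ψ w ∧ (#(m ∪ Ψ w) < l ∨ n < l + #(m ∪ Ψ w)) ∧
        ((#m + #w < l ∨ n < l + (#m + #w)) → Ψ w = w) ∧
        (¬(#m + #w < l ∨ n < l + (#m + #w)) → 2 * #w < q ∧ Ψ w = τ #w w ∧ #(Ψ w) + #w = q) := by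
    intro w hwZ' hout
    have hwq : #w ≤ q := by rw [hq]; exact card_le_card hwZ'
    by_cases hc : #m + #w < l ∨ n < l + (#m + #w)
    · have hΨw : Ψ w = w := if_pos hc
      refine ⟨by rw [hΨw]; exact hwZ', by rw [hΨw], ?_, fun _ => hΨw, fun h => absurd hc h⟩
      rw [hΨw, hcardmw w hwZ']; exact hc
    · have hΨw : Ψ w = τ #w w := if_neg hc
      have h2 : 2 * #w < q := by omega
      have hwmem : w ∈ Z.powersetCard #w := mem_powersetCard.2 ⟨hwZ', rfl⟩
      obtain ⟨hmem, hsub⟩ := (hτ #w h2).2 w hwmem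
      rw [mem_powersetCard] at hmem
      have hcardτ : #(τ #w w) + #w = q := by rw [hmem.2]; omega
      refine ⟨by rw [hΨw]; exact hmem.1, by rw [hΨw]; exact hsub, ?_, fun h => absurd h hc,
        fun _ => ⟨h2, hΨw, by rw [hΨw]; exact hcardτ⟩⟩
      rw [hΨw, hcardmw _ hmem.1]; omega
  -- outer ⇔ additive form
  have houter : ∀ s : Finset β, (#s < l ∨ #sᶜ < l) ↔ (#s < l ∨ n < l + #s) := by
    intro s; rw [hcc]; have := hle s; omega
  apply card_le_card_of_injOn Φ
  · -- maps to
    intro x hx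
    rw [mem_coe, mem_filter, mem_inter, hcyl, mem_compls, houter] at hx
    obtain ⟨⟨⟨hmx, hxM⟩, hxcV⟩, hout⟩ := hx
    have hw := hwZ x hxM hmx
    obtain ⟨hc, hmx', hwq⟩ := hwcard x hxM hmx
    have hout' : #m + q < l + #(M \ x) ∨ n + #(M \ x) < l + (#m + q) := by omega
    obtain ⟨hΨZ, hwΨ, hΨout, -, -⟩ := hΨ (M \ x) hw hout'
    rw [mem_coe, mem_filter, mem_inter, hcyl, houter]
    refine ⟨⟨⟨subset_union_left, union_subset hmM (hΨZ.trans sdiff_subset)⟩, ?_⟩, hΨout⟩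
    have h1 : m ∪ (M \ x) ∈ V := hdom _ hw (by rw [← hcompl x hxM]; exact hxcV)
    exact hV (union_subset_union le_rfl hwΨ : m ∪ (M \ x) ⊆ m ∪ Ψ (M \ x)) h1
  · -- injective
    intro x₁ hx₁ x₂ hx₂ heq
    rw [mem_coe, mem_filter, mem_inter, hcyl, mem_compls, houter] at hx₁ hx₂
    obtain ⟨⟨⟨hmx₁, hx₁M⟩, -⟩, hout₁⟩ := hx₁
    obtain ⟨⟨⟨hmx₂, hx₂M⟩, -⟩, hout₂⟩ := hx₂
    have hw₁ := hwZ x₁ hx₁M hmx₁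
    have hw₂ := hwZ x₂ hx₂M hmx₂
    obtain ⟨hc₁, hm₁, hq₁⟩ := hwcard x₁ hx₁M hmx₁
    obtain ⟨hc₂, hm₂, hq₂⟩ := hwcard x₂ hx₂M hmx₂
    have hout₁' : #m + q < l + #(M \ x₁) ∨ n + #(M \ x₁) < l + (#m + q) := by omega
    have hout₂' : #m + q < l + #(M \ x₂) ∨ n + #(M \ x₂) < l + (#m + q) := by omega
    obtain ⟨hΨZ₁, -, -, hid₁, hτ₁⟩ := hΨ (M \ x₁) hw₁ hout₁'
    obtain ⟨hΨZ₂, -, -, hid₂, hτ₂⟩ := hΨ (M \ x₂) hw₂ hout₂'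
    -- `Ψ (M \ x₁) = Ψ (M \ x₂)`
    have hΨeq : Ψ (M \ x₁) = Ψ (M \ x₂) := by
      have h : (m ∪ Ψ (M \ x₁)) \ m = (m ∪ Ψ (M \ x₂)) \ m := by show Φ x₁ \ m = Φ x₂ \ m; rw [heq]
      rwa [union_sdiff_cancel_left (hmZ.mono_right hΨZ₁), union_sdiff_cancel_left (hmZ.mono_right hΨZ₂)] at h
    -- recover `M \ x₁ = M \ x₂`
    have hweq : M \ x₁ = M \ x₂ := by
      by_cases h₁ : #m + #(M \ x₁) < l ∨ n < l + (#m + #(M \ x₁)) <;>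
        by_cases h₂ : #m + #(M \ x₂) < l ∨ n < l + (#m + #(M \ x₂))
      · rwa [hid₁ h₁, hid₂ h₂] at hΨeq
      · exfalso
        obtain ⟨-, -, hcard₂⟩ := hτ₂ h₂
        rw [hid₁ h₁] at hΨeq
        rw [← hΨeq] at hcard₂
        omega
      · exfalso
        obtain ⟨-, -, hcard₁⟩ := hτ₁ h₁
        rw [hid₂ h₂] at hΨeq
        rw [hΨeq] at hcard₁
        omega
      · obtain ⟨hlt₁, hΨ₁, hcard₁⟩ := hτ₁ h₁
        obtain ⟨hlt₂, hΨ₂, hcard₂⟩ := hτ₂ h₂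
        have hjj : #(M \ x₁) = #(M \ x₂) := by rw [hΨeq] at hcard₁; omega
        rw [hΨ₁, hΨ₂, hjj] at hΨeq
        exact (hτ #(M \ x₂) hlt₂).1 (mem_powersetCard.2 ⟨hw₁, hjj⟩) (mem_powersetCard.2 ⟨hw₂, rfl⟩) hΨeq
    rw [← Finset.sdiff_sdiff_eq_self hx₁M, ← Finset.sdiff_sdiff_eq_self hx₂M, hweq]

/-- **(AB_l) from a cylinder partition.**  If the outer members of `W` (`#x < l ∨ #xᶜ < l`) are exactly the outer members of a union of cylinders
`[p.1, p.2]` (`p ∈ P`), pairwise disjoint on outer sets, each satisfying the hypotheses of `cylinder_antiBand`, then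
`#{s ∈ W ∩ Vᶜˢ | outer s} ≤ #{s ∈ W ∩ V | outer s}`. [this work, FINDING-CYLINDER-g34.md §1] -/
theorem antiBand_of_cylinder_partition (l : ℕ) (W V : Finset (Finset β)) (hV : IsUpperSet (V : Set (Finset β)))
    (P : Finset (Finset β × Finset β))
    (hP : ∀ p ∈ P, p.1 ⊆ p.2 ∧ Fintype.card β ≤ 2 * #p.1 + #(p.2 \ p.1) ∧ ∀ w ⊆ p.2 \ p.1, p.2ᶜ ∪ w ∈ V → p.1 ∪ w ∈ V)
    (hdisj : ∀ p ∈ P, ∀ p' ∈ P, p ≠ p' → ∀ x : Finset β, (#x < l ∨ #xᶜ < l) → p.1 ⊆ x → x ⊆ p.2 → p'.1 ⊆ x → x ⊆ p'.2 → False)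
    (hcover : ∀ x : Finset β, (#x < l ∨ #xᶜ < l) → (x ∈ W ↔ ∃ p ∈ P, p.1 ⊆ x ∧ x ⊆ p.2)) :
    #((W ∩ Vᶜˢ).filter fun s => #s < l ∨ #sᶜ < l) ≤ #((W ∩ V).filter fun s => #s < l ∨ #sᶜ < l) := by
  classical
  have hmemcyl : ∀ (p : Finset β × Finset β) (x : Finset β), x ∈ p.2.powerset.filter (fun x => p.1 ⊆ x) ↔ p.1 ⊆ x ∧ x ⊆ p.2 :=
    fun p x => by rw [mem_filter, mem_powerset]; exact and_comm
  have hsplit : ∀ X : Finset (Finset β), (W ∩ X).filter (fun s => #s < l ∨ #sᶜ < l)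
      = P.biUnion fun p => ((p.2.powerset.filter fun x => p.1 ⊆ x) ∩ X).filter fun s => #s < l ∨ #sᶜ < l := by
    intro X; ext x; rw [mem_filter, mem_inter, mem_biUnion]
    constructor
    · rintro ⟨⟨hxW, hxX⟩, hout⟩
      obtain ⟨p, hp, h1, h2⟩ := (hcover x hout).1 hxW
      exact ⟨p, hp, mem_filter.2 ⟨mem_inter.2 ⟨(hmemcyl p x).2 ⟨h1, h2⟩, hxX⟩, hout⟩⟩
    · rintro ⟨p, hp, hx⟩
      rw [mem_filter, mem_inter, hmemcyl] at hx
      exact ⟨⟨(hcover x hx.2).2 ⟨p, hp, hx.1.1⟩, hx.1.2⟩, hx.2⟩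
  have hdisj' : ∀ p ∈ P, ∀ p' ∈ P, p ≠ p' → Disjoint (((p.2.powerset.filter fun x => p.1 ⊆ x) ∩ V).filter fun s => #s < l ∨ #sᶜ < l)
      (((p'.2.powerset.filter fun x => p'.1 ⊆ x) ∩ V).filter fun s => #s < l ∨ #sᶜ < l) := by
    intro p hp p' hp' hne
    rw [disjoint_left]
    intro x hx hx'
    rw [mem_filter, mem_inter, hmemcyl] at hx hx'
    exact hdisj p hp p' hp' hne x hx.2 hx.1.1.1 hx.1.1.2 hx'.1.1.1 hx'.1.1.2
  rw [hsplit Vᶜˢ, hsplit V, card_biUnion hdisj']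
  refine card_biUnion_le.trans (sum_le_sum fun p hp => ?_)
  obtain ⟨h1, h2, h3⟩ := hP p hp
  exact cylinder_antiBand l V hV p.1 p.2 h1 h2 h3

/-- **(AB_l) for a principal filter, every `l`, every upper set `V`** — the one-cylinder partition `[m, univ]`:
`#{s ⊇ m | sᶜ ∈ V, outer s} ≤ #{s ⊇ m | s ∈ V, outer s}`.  (Gen 32's `AntiBandPrincipal` theorem; here a corollary of the cylinder lemma, with no
hypothesis on `l` or `card β`.) [this work] -/
theorem antiBand_principal_filter (l : ℕ) (m : Finset β) (V : Finset (Finset β)) (hV : IsUpperSet (V : Set (Finset β))) :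
    #(((univ.filter fun x : Finset β => m ⊆ x) ∩ Vᶜˢ).filter fun s => #s < l ∨ #sᶜ < l)
      ≤ #(((univ.filter fun x : Finset β => m ⊆ x) ∩ V).filter fun s => #s < l ∨ #sᶜ < l) := by
  classical
  rw [← powerset_univ]
  refine cylinder_antiBand l V hV m univ (subset_univ m) ?_ (fun w _ hw => ?_)
  · rw [card_sdiff_of_subset (subset_univ m), card_univ]; have := card_le_univ m; omega
  · have h : (univ : Finset β)ᶜ ∪ w = w := by rw [compl_univ, empty_union]
    rw [h] at hw
    exact hV (subset_union_right : w ⊆ m ∪ w) hw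

section Shifted

variable {n : ℕ}

/-- One right-shift inside a right-shifted family: if `V` is compressed along `({j}, {i})` and `S ∈ V` with `i ∈ S`, `j ∉ S`, then
`insert j (S.erase i) ∈ V`. [folklore] -/
theorem insert_erase_mem_of_isCompressed {V : Finset (Finset (Fin n))} {i j : Fin n}
    (hV : UV.IsCompressed ({j} : Finset (Fin n)) {i} V) {S : Finset (Fin n)} (hS : S ∈ V) (hi : i ∈ S) (hj : j ∉ S) :
    insert j (S.erase i) ∈ V := by
  have hc : UV.compress ({j} : Finset (Fin n)) {i} S = insert j (S.erase i) := by
    rw [UV.compress_of_disjoint_of_le (disjoint_singleton_left.2 hj) (singleton_subset_iff.2 hi)]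
    ext x
    rw [mem_sdiff, sup_eq_union, mem_union, mem_singleton, mem_singleton, mem_insert, mem_erase]
    constructor
    · rintro ⟨h1 | h1, h2⟩; exacts [Or.inr ⟨h2, h1⟩, Or.inl h1]
    · rintro (h1 | ⟨h1, h2⟩)
      exacts [⟨Or.inr h1, fun h => hj (by rw [show j = i from h1.symm.trans h]; exact hi)⟩, ⟨Or.inl h2, h1⟩]
  have h := UV.compress_mem_compression (u := ({j} : Finset (Fin n))) (v := {i}) hS
  rw [hc] at h
  rw [UV.IsCompressed] at hV
  rwa [hV] at h

/-- Iterated right-shifts: if `V` is compressed along `({j},{i})` for all `i < j`, `E ⊆ S ∈ V`, `π` is injective on `E` with `i < π i` and `π i ∉ S`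
for `i ∈ E` (images pairwise outside `S`), then `(S \ E) ∪ E.image π ∈ V`. [folklore] -/
theorem sdiff_union_image_mem_of_isCompressed {V : Finset (Finset (Fin n))}
    (hV : ∀ i j : Fin n, i < j → UV.IsCompressed ({j} : Finset (Fin n)) {i} V) (π : Fin n → Fin n) :
    ∀ (E S : Finset (Fin n)), E ⊆ S → S ∈ V → Set.InjOn π ↑E → (∀ i ∈ E, i < π i ∧ π i ∉ S) → (S \ E) ∪ E.image π ∈ V := by
  classical
  intro E
  induction E using Finset.induction_on with
  | empty => intro S _ hS _ _; rwa [image_empty, union_empty, sdiff_empty]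
  | @insert i E hiE ih =>
    intro S hES hS hinj hπ
    obtain ⟨hiπ, hπiS⟩ := hπ i (mem_insert_self i E)
    -- first move `i` to `π i`
    set S₁ : Finset (Fin n) := insert (π i) (S.erase i) with hS₁
    have hS₁V : S₁ ∈ V := insert_erase_mem_of_isCompressed (hV i (π i) hiπ) hS (hES (mem_insert_self i E)) hπiS
    have hES₁ : E ⊆ S₁ := fun e he => by
      rw [hS₁, mem_insert, mem_erase]
      exact Or.inr ⟨fun h => hiE (h ▸ he), hES (mem_insert_of_mem he)⟩
    have hinjE : Set.InjOn π ↑E := fun a ha b hb h => hinj (mem_insert_of_mem ha) (mem_insert_of_mem hb) h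
    have hπE : ∀ e ∈ E, e < π e ∧ π e ∉ S₁ := by
      intro e he
      refine ⟨(hπ e (mem_insert_of_mem he)).1, fun h => ?_⟩
      rw [hS₁, mem_insert, mem_erase] at h
      rcases h with h | h
      · exact hiE ((hinj (mem_insert_of_mem he) (mem_insert_self i E) h) ▸ he)
      · exact (hπ e (mem_insert_of_mem he)).2 h.2
    have h := ih S₁ hES₁ hS₁V hinjE hπE
    have heq : (S₁ \ E) ∪ E.image π = (S \ insert i E) ∪ (insert i E).image π := by
      ext x
      rw [mem_union, mem_sdiff, hS₁, mem_insert, mem_erase, mem_union, mem_sdiff, mem_insert, image_insert, mem_insert]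
      constructor
      · rintro (⟨h1 | ⟨h2, h3⟩, h4⟩ | h5)
        exacts [Or.inr (Or.inl h1), Or.inl ⟨h3, fun h => h.elim h2 h4⟩, Or.inr (Or.inr h5)]
      · rintro (⟨h1, h2⟩ | h3 | h4)
        exacts [Or.inl ⟨Or.inr ⟨fun h => h2 (Or.inl h), h1⟩, fun h => h2 (Or.inr h)⟩,
          Or.inl ⟨Or.inl h3, fun hx => hπiS (h3 ▸ hES (mem_insert_of_mem hx))⟩, Or.inr h4]
    rwa [heq] at h

/-- **Domination ⇒ the hypothesis of the cylinder lemma.**  If `V` is a RIGHT-shifted upper set on `Fin n` (compressed along `({j},{i})` for all `i < j`),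
`m ⊆ M`, and there is an injection `π : Mᶜ → m` with `i < π i`, then `Mᶜ ∪ w ∈ V → m ∪ w ∈ V` for every `w ⊆ M \ m`. [this work] -/
theorem dominates_of_isCompressed {V : Finset (Finset (Fin n))} (hVup : IsUpperSet (V : Set (Finset (Fin n))))
    (hV : ∀ i j : Fin n, i < j → UV.IsCompressed ({j} : Finset (Fin n)) {i} V) (m M : Finset (Fin n)) (hmM : m ⊆ M)
    (π : Fin n → Fin n) (hπ : ∀ i ∈ Mᶜ, π i ∈ m ∧ i < π i) (hinj : Set.InjOn π ↑Mᶜ) :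
    ∀ w ⊆ M \ m, Mᶜ ∪ w ∈ V → m ∪ w ∈ V := by
  classical
  intro w hw hMw
  have hwM : w ⊆ M := hw.trans sdiff_subset
  have hwm : Disjoint w m := disjoint_sdiff_self_left.mono_left hw
  have hπ' : ∀ i ∈ Mᶜ, i < π i ∧ π i ∉ Mᶜ ∪ w := by
    intro i hi
    refine ⟨(hπ i hi).2, fun h => ?_⟩
    rcases mem_union.1 h with h | h
    · exact (mem_compl.1 h) (hmM (hπ i hi).1)
    · exact disjoint_left.1 hwm h (hπ i hi).1
  have h := sdiff_union_image_mem_of_isCompressed hV π Mᶜ (Mᶜ ∪ w) subset_union_left hMw hinj hπ'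
  have hsd : (Mᶜ ∪ w) \ Mᶜ = w := by
    rw [union_sdiff_left]  -- `(s ∪ t) \ s = t \ s`
    exact sdiff_eq_self_of_disjoint (disjoint_left.2 fun x hxw hxM => (mem_compl.1 hxM) (hwM hxw))
  rw [hsd] at h
  refine hVup (?_ : w ∪ Mᶜ.image π ⊆ m ∪ w) h
  refine union_subset subset_union_right fun x hx => ?_
  obtain ⟨i, hi, rfl⟩ := mem_image.1 hx
  exact mem_union_left _ (hπ i hi).1

/-- **(AB_l) against right-shifted `V` from a partition into DOMINATED cylinders.**  On `Fin n`: if the outer members of `W` are exactly the outer members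
of pairwise (outer-)disjoint cylinders `[p.1, p.2]`, `p.1 ⊆ p.2`, each with an injection `π_p : (p.2)ᶜ → p.1`, `i < π_p i`, then
`#{s ∈ W ∩ Vᶜˢ | outer s} ≤ #{s ∈ W ∩ V | outer s}` for every right-shifted upper set `V` and every `l`.  (For a left-shifted `W`, gen 20's
opposite-compression lemma `AntiBandShift.antiBand_compression_swap_le` makes right-shifted `V` the only case to check.) [this work] -/
theorem antiBand_of_dominated_cylinders (l : ℕ) (W V : Finset (Finset (Fin n))) (hVup : IsUpperSet (V : Set (Finset (Fin n))))
    (hV : ∀ i j : Fin n, i < j → UV.IsCompressed ({j} : Finset (Fin n)) {i} V)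
    (P : Finset (Finset (Fin n) × Finset (Fin n)))
    (hP : ∀ p ∈ P, p.1 ⊆ p.2 ∧ ∃ π : Fin n → Fin n, (∀ i ∈ (p.2)ᶜ, π i ∈ p.1 ∧ i < π i) ∧ Set.InjOn π ↑(p.2)ᶜ)
    (hdisj : ∀ p ∈ P, ∀ p' ∈ P, p ≠ p' → ∀ x : Finset (Fin n), (#x < l ∨ #xᶜ < l) → p.1 ⊆ x → x ⊆ p.2 → p'.1 ⊆ x → x ⊆ p'.2 → False)
    (hcover : ∀ x : Finset (Fin n), (#x < l ∨ #xᶜ < l) → (x ∈ W ↔ ∃ p ∈ P, p.1 ⊆ x ∧ x ⊆ p.2)) :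
    #((W ∩ Vᶜˢ).filter fun s => #s < l ∨ #sᶜ < l) ≤ #((W ∩ V).filter fun s => #s < l ∨ #sᶜ < l) := by
  classical
  refine antiBand_of_cylinder_partition l W V hVup P (fun p hp => ?_) hdisj hcover
  obtain ⟨h1, π, hπ, hinj⟩ := hP p hp
  refine ⟨h1, ?_, dominates_of_isCompressed hVup hV p.1 p.2 h1 π hπ hinj⟩
  -- `#(p.2)ᶜ ≤ #p.1` from the injection
  have hle : #(p.2)ᶜ ≤ #p.1 := by
    rw [← card_image_of_injOn hinj]
    exact card_le_card fun x hx => by obtain ⟨i, hi, rfl⟩ := mem_image.1 hx; exact (hπ i hi).1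
  rw [card_compl, Fintype.card_fin] at hle
  rw [Fintype.card_fin, card_sdiff_of_subset h1]
  have := card_le_card h1; have h3 : #p.2 ≤ n := by have := card_le_univ p.2; rwa [Fintype.card_fin] at this
  omega

end Shifted

end Summit.CriticalPhenomena.PercolationContinuityZ3.Theorems.AntiBandCylinder
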